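import Mathlib
import Summits.Ventures.PercRepro2.LocRows
import Summits.Ventures.PercRepro2.SwRow
import Summits.Ventures.PercRepro2.SwOut
import Summits.Ventures.PercRepro2.SwAllRow
import Summits.Ventures.PercRepro2.SwOutAll
import Summits.Ventures.PercRepro2.SwOutArmFlip
import Summits.Ventures.PercRepro2.SwOutArms
import Summits.Ventures.PercRepro2.SwOutArmThm
import Summits.Ventures.PercRepro2.SwOutCoreDefs
import Summits.Ventures.PercRepro2.SwOutCoreHull
import Summits.Ventures.PercRepro2.SwOutCoreDual
import Summits.Ventures.PercRepro2.SwOutCoreCube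
import Summits.Ventures.PercRepro2.SwOutCoreKey
import Summits.Ventures.PercRepro2.SwOutShadowDefs
import Summits.Ventures.PercRepro2.SwOutShadowCube
import Summits.Ventures.PercRepro2.SwOutShadowIneq
import Summits.Ventures.PercRepro2.SwOutCoreShadowDefs
import Summits.Ventures.PercRepro2.SwOutCoreShadow
import Summits.Ventures.PercRepro2.SwOutCoreShadowFlip
import Summits.Ventures.PercRepro2.SwOutCoreShadowEsc
import Summits.Ventures.PercRepro2.SwOutJunction
import Summits.Ventures.PercRepro2.SwOutJunctionRegion
import Summits.Ventures.PercRepro2.SwOutJunctionH1Defs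
import Summits.Ventures.PercRepro2.SwOutJunctionH1Arms
import Summits.Ventures.PercRepro2.SwOutCoreToggle
import Summits.Ventures.PercRepro2.SwOutCoreShadowArm
import Summits.Ventures.PercRepro2.SwOutCoreShadowKey

/-!
# The shadow kind (blind cell PercRepro2, night-4 g14, 2026-08-26; proofs/NIGHT4-G14.md §3)

`ShadowData ends U ξ h u b S R` records that `(b, S, R)` is the key of a shadow block of the
class: `S` are the arms of `b`, `b` is a core base (on its concrete arms) lying in the class with
its extended hull inside `U`, `omegaSR S R` is a one-sided point of it with a dropped arm adjacent
to `u`, and `R` has its canonical form (the far arms and the red u-adjacent arms).  A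
configuration is of the SHADOW KIND (`ShadowKind`) when its own key carries shadow data and it
lies in the shadow block of its key.  **`shadowKind_of_mem_shadowBlock`**: every `Q`-point of a
shadow block of a key with shadow data is of the shadow kind with that key — the constancy of the
key along a shadow block (NIGHT4-G13.md §4 (S)); `hR_of_mem_shadowBlock`: the canonical form of
the red arms; `shadowBlock_card_le`: the rigid inequality on a shadow block.
-/

namespace Summit.Ventures.PercRepro2

namespace LocRows

open Hull

variable {V : Type*} {E : Type*} [Fintype E] [DecidableEq E]

open scoped Classical

variable {ends : E → Sym2 V}

/-- **Shadow data** of a key `(b, S, R)`: the arms, the core base in the class, the one-sided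
point with a dropped arm, and the canonical form of `R`. -/
structure ShadowData (ends : E → Sym2 V) (U : Set V) (ξ : Config E) (h u : V) (b : Config E)
    (S R : Finset (Set V)) : Prop where
  hS : S = armsC ends h u b
  hb : CoreBase ends b h u (extHull ends b h u) (armsFun S) (pureFun ends h S)
  hHU : extHull ends b h u ⊆ U
  hbcl : b ∈ outClass ends U h ξ
  huR : uRed ends (armsFun S) u (pureFun ends h S) (omegaSR S R)
  huB : ¬ uRed ends (armsFun S) u (pureFun ends h S) (flipAll (omegaSR S R))
  hZ : ∃ P : S, uAdjC ends u (armsFun S) P ∧ omegaSR S R P = false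
  hR : R = S.filter fun P => (∃ e x, ends e = s(u, x) ∧ x ∈ P) → P ∈ R

/-- **The shadow kind**: the key of `ζ` carries shadow data and `ζ` lies in its block. -/
def ShadowKind (ends : E → Sym2 V) (U : Set V) (ξ : Config E) (h u : V) (ζ : Config E) : Prop :=
  ShadowData ends U ξ h u (baseOf ends h u ζ) (armsOf ends h u ζ) (redOf ends h u ζ) ∧
    ζ ∈ shadowBlock ends u (baseOf ends h u ζ) (armsOf ends h u ζ) (redOf ends h u ζ)

section Kind

variable {U : Set V} {ξ : Config E} {l h o u : V} {b : Config E} {S R : Finset (Set V)}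

/-- **The constancy of the key along a shadow block**: a `Q`-point of the shadow block of a key
with shadow data is of the shadow kind with that key, lies in the class, and is escaping. -/
theorem shadowKind_of_mem_shadowBlock (hl : l ∉ U)
    (hout : ∀ x ∈ U, x ≠ h → x ≠ o → x ≠ u →
      (∃ e y, ends e = s(x, y) ∧ y ∉ U) ∨ (∀ e, x ∉ ends e))
    (hd : ShadowData ends U ξ h u b S R) {ζ' : Config E} (hζ' : ζ' ∈ shadowBlock ends u b S R)
    (hQ : ζ' ∈ tgtU ends l h {T : Set V | o ∈ T}) :
    baseOf ends h u ζ' = b ∧ armsOf ends h u ζ' = S ∧ redOf ends h u ζ' = R ∧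
      ShadowKind ends U ξ h u ζ' ∧ ζ' ∈ swOutSide ends l h o U ξ ∧ u ∈ hull ends ζ' h ∧
      ¬ hull ends ζ' u ⊆ U := by
  have h1 := baseOf_of_mem_shadowBlock hd.hS hd.hb hd.huR hd.huB hζ'
  have h2 := armsOf_of_mem_shadowBlock hd.hS hd.hb hd.huR hd.huB hζ'
  have h3 : redOf ends h u ζ' = R := by
    rw [redOf_of_mem_shadowBlock hd.hS hd.hb hd.huR hd.huB hζ', ← hd.hR]
  refine ⟨h1, h2, h3, ⟨by rw [h1, h2, h3]; exact hd, by rw [h1, h2, h3]; exact hζ'⟩, ?_,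
    u_mem_hull_of_mem_shadowBlock hd.hb hd.huR hd.huB hζ',
    not_hull_u_subset_of_mem_shadowBlock hl hout hd.hHU hd.hb hd.huR hd.huB hd.hZ hζ' hQ⟩
  exact mem_swOutSide.2 ⟨hQ, mem_outClass_of_mem_shadowBlock hd.hHU hd.hb hd.huR hd.huB hd.hbcl hζ'⟩

omit [DecidableEq E] in
/-- The canonical form of the red arms of a point of a shadow block. -/
theorem hR_of_mem_shadowBlock (hS : S = armsC ends h u b)
    (hb : CoreBase ends b h u (extHull ends b h u) (armsFun S) (pureFun ends h S))
    (huR : uRed ends (armsFun S) u (pureFun ends h S) (omegaSR S R))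
    (huB : ¬ uRed ends (armsFun S) u (pureFun ends h S) (flipAll (omegaSR S R)))
    {ζ : Config E} (hζ : ζ ∈ shadowBlock ends u b S R) (hRζ : R = redOf ends h u ζ) :
    R = S.filter fun P => (∃ e x, ends e = s(u, x) ∧ x ∈ P) → P ∈ R := by
  exact hRζ.trans (redOf_of_mem_shadowBlock hS hb huR huB hζ)

/-- **The rigid inequality on a shadow block.** -/
theorem shadowBlock_card_le (hl : l ∉ U) (hHU : extHull ends b h u ⊆ U)
    (hb : CoreBase ends b h u (extHull ends b h u) (armsFun S) (pureFun ends h S))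
    (huR : uRed ends (armsFun S) u (pureFun ends h S) (omegaSR S R))
    (huB : ¬ uRed ends (armsFun S) u (pureFun ends h S) (flipAll (omegaSR S R)))
    {𝓔 : Set (Set E)} (h𝓔 : IsUpperSet 𝓔) :
    ((shadowBlock ends u b S R).filter fun ζ' =>
        ζ' ∈ tgtU ends l h {T : Set V | o ∈ T} ∧ redEdges ends ζ' h ∈ 𝓔).card ≤
      ((shadowBlock ends u b S R).filter fun ζ' =>
        ζ' ∈ tgtU ends l h {T : Set V | o ∈ T} ∧ blueEdges ends ζ' h ∈ 𝓔).card := by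
  refine (hb.shadowBase huR huB).card_shadowCube_le ?_ h𝓔
  rw [hb.shadow_region_eq]
  exact fun h' => hl (hHU h')

end Kind

end LocRows

end Summit.Ventures.PercRepro2
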